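import Literature.AlgebraicGeometry.Frobenioids.FrobenioidRealification
import Literature.AlgebraicGeometry.Frobenioids.DegreeModelFrobenioid
import Literature.AlgebraicGeometry.Frobenioids.ModelFrobenioidTypeBridge
import Mathlib.CategoryTheory.Category.Preorder
import HarnessLib

/-!
# Frobenioids I, Prop. 5.3 "In particular" as the schema `PreFrobenioid.Prop53_diagram F P SU PU` over
# DATA-ONLY perfection interfaces: the universal closure is false (junk data over a GENUINE Frobenioid)

Mochizuki, *The geometry of Frobenioids I: the general theory*, Kyushu J. Math. **62** (2008) 293–400,
§5, Proposition 5.3, kurims p. 103: "there is a natural 1-commutative diagram of functors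
`C → C^istr → C^pf` over `C^un-tr → (C^un-tr)^pf → C^rlf`" [cite: MochizukiFrdI2008, Prop. 5.3 p.103].

PROOF-ONLY companion (no definitions, no instances) of `FrobenioidRealification.lean` (seat
abc-iut-L1-t3); cell abc-iut, block F, seat abc-iut-f-045.  FACT-LIST row **F-1095**
`PreFrobenioid.Prop53_diagram F P SU PU := IsFrobenioid F → (Frobenius-isotropic type) → ∃ pfUntr :
C^pf ⥤ (C^un-tr)^pf, (C^istr ⊆ C → C^pf → (C^un-tr)^pf) ≅ (C^istr → C^un-tr → (C^un-tr)^pf)` is, by its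
own docstring, a "SCHEMA in `P`, `SU`, `PU`": the perfections `P : PerfectionData _`, `PU : PerfectionData
SU` and the operations `SU` on `C^un-tr` are DATA-ONLY interfaces (`PerfectionData`: a category, a functor
`toPf`, roots, operations — no axioms tying them to THE perfection of Def. 3.1 (iii); cf. the tree's own
warning at `Prop32iii`: "never quantify universally over them — a junk datum refutes any such `∀`").  The
instance of record binds them to THE perfections: `PreFrobenioid.prop53_diagram_holds (hF : IsFrobenioid F)`
(`FrobenioidRealificationProp53Diagram.lean`).  The R7 kernel TYPE-audit (abc-iut-w5-d044) found no
theorem over ALL `(P, SU, PU)`; there is none: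
* `not_forall_prop53_diagram` — over the GENUINE Frobenioid of standard (hence Frobenius-isotropic) type
  `DegreeModel.C` (the model Frobenioid of `(pt, ℕ, 0, 0)`, [FrdI] Thm. 5.2: objects the integers `ι d`,
  arrows `d → e` the pairs `(k, c)` with `e = k·d + c`), take the junk "perfection" `P` with `C^pf := ∗`
  (one object, `toPf` constant) and the junk "perfection of `C^un-tr`" `PU` with `(C^un-tr)^pf := (0 → 1)`
  (the walking arrow) and `toPf` the degree indicator `[deg ≥ 1]` (a functor: arrows of `C` out of objects
  of degree `≥ 1` land in degree `≥ 1`), descended to `C^un-tr = C^istr/≈`.  Any `pfUntr : ∗ ⥤ (0 → 1)`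
  makes the top composite CONSTANT, while the bottom composite sends `ι 0 ↦ 0`, `ι 1 ↦ 1` — not
  isomorphic.
So F-1095 is admissible AT THE NAMED INSTANCE ONLY (R5).  Refuted-closure ≠ refuted-paper; a FACT row is an
assumption label, not an endorsement; nothing here bears on [IUTchIII] Cor. 3.12.
-/

noncomputable section

namespace Literature.AlgebraicGeometry.Frobenioids

open CategoryTheory Opposite DegreeModel

/-- In the model Frobenioid of `(pt, ℕ, 0, 0)`, arrows out of an object of degree `≥ 1` land in degree
`≥ 1` (`deg_Fr(φ) · dg X ≤ dg Y`). [cite: MochizukiFrdI2008, Thm. 5.2 (i) p.100] -/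
theorem DegreeModel.one_le_dg_of_hom {X Y : C} (φ : X ⟶ Y) (hX : 1 ≤ dg X) : 1 ≤ dg Y := by
  have h := degFr_mul_dg_le φ
  have hk : (1 : ℤ) ≤ ((ModelFrobenioid.degFr φ : ℕ) : ℤ) := by
    have := (ModelFrobenioid.degFr φ).pos
    omega
  nlinarith

/-- **FACT-LIST F-1095, universal closure REFUTED** (universe `0`; see the module docstring for the junk
perfection data over the genuine Frobenioid `DegreeModel.C`).  Instance of record:
`PreFrobenioid.prop53_diagram_holds (hF : IsFrobenioid F)` (THE perfections).
[cite: MochizukiFrdI2008, Prop. 5.3 p.103] -/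
theorem not_forall_prop53_diagram :
    ¬ ∀ (D : Type) [Category.{0} D] (Φ : Dᵒᵖ ⥤ CommMonCat.{0}) (C : Type) [Category.{0} C]
        (F : C ⥤ ElemFrobenioid Φ) (P : PerfectionData (PreFrobenioidData.ofFunctor Φ F))
        (SU : PreFrobenioidData.{0} (PreFrobenioidData.ofFunctor Φ F).Untr D) (PU : PerfectionData SU),
        PreFrobenioid.Prop53_diagram F P SU PU := by
  intro h
  -- the genuine Frobenioid and its operations
  let S₀ : PreFrobenioidData.{0} C D := PreFrobenioidData.ofFunctor natΦ F
  have hiso : S₀.IsOfIsotropicType := ModelFrobenioid.data_isOfIsotropicType objectwise_isGroupLike_B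
  have hfi : PreFrobenioid.IsOfType (PreFrobenioid.IsFrobeniusIsotropic F) := fun A =>
    ⟨A, 𝟙 A, (PreFrobenioidData.ofFunctor_isFrobeniusType F (𝟙 A)).mp
        (ModelFrobenioid.data_isFrobeniusType_id objectwise_isGroupLike_B A),
      ModelFrobenioid.isIsotropic objectwise_isGroupLike_B A⟩
  -- junk operations over `D` on any category: base constant at `pt`, `Φ = 0`, `deg_Fr = 1`
  have junk : ∀ (E : Type) [Category.{0} E], PreFrobenioidData.{0} E D := fun E _ =>
    { base := (Functor.const E).obj pt
      Mon := fun _ => PUnit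
      pull := fun _ => MonoidHom.id _
      pull_id := fun _ _ => rfl
      pull_comp := fun _ _ _ => rfl
      div := fun _ => 1
      degFr := fun _ => 1
      div_id := fun _ => rfl
      div_comp := fun _ _ => rfl
      degFr_id := fun _ => rfl
      degFr_comp := fun _ _ => (mul_one _).symm }
  -- the junk perfection of `C`: one object
  let P : PerfectionData S₀ :=
    { Pf := Discrete PUnit.{1}
      toPf := (Functor.const C).obj ⟨PUnit.unit⟩
      root := fun _ _ => ⟨PUnit.unit⟩
      root_one := fun _ => rfl
      root_surjective := fun X => ⟨ι 0, 1, Subsingleton.elim _ _⟩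
      ops := junk _ }
  -- the degree indicator `C ⥤ (0 → 1)`
  let deg01 : C → Fin 2 := fun X => if 1 ≤ dg X then 1 else 0
  have hmono : ∀ {X Y : C} (_ : X ⟶ Y), deg01 X ≤ deg01 Y := fun {X Y} φ => by
    simp only [deg01]
    by_cases hX : 1 ≤ dg X
    · rw [if_pos hX, if_pos (DegreeModel.one_le_dg_of_hom φ hX)]
    · rw [if_neg hX]
      exact Fin.zero_le _
  let degFun : C ⥤ Fin 2 :=
    { obj := deg01
      map := fun φ => homOfLE (hmono φ)
      map_id := fun _ => Subsingleton.elim _ _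
      map_comp := fun _ _ => Subsingleton.elim _ _ }
  -- the junk operations on `C^un-tr` and its junk perfection `(0 → 1)` with `toPf` the descended indicator
  let SU : PreFrobenioidData.{0} S₀.Untr D := junk _
  let toPfU : S₀.Untr ⥤ Fin 2 :=
    CategoryTheory.Quotient.lift S₀.UnitEquiv (S₀.istrι ⋙ degFun) fun _ _ _ _ _ => Subsingleton.elim _ _
  let A₀ : S₀.Istr := ⟨ι 0, hiso.obj _⟩
  let A₁ : S₀.Istr := ⟨ι 1, hiso.obj _⟩
  have h0 : (S₀.toUntr ⋙ toPfU).obj A₀ = (0 : Fin 2) := by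
    change (if 1 ≤ dg (ι 0) then (1 : Fin 2) else 0) = 0
    rw [dg_ι]; rfl
  have h1 : (S₀.toUntr ⋙ toPfU).obj A₁ = (1 : Fin 2) := by
    change (if 1 ≤ dg (ι 1) then (1 : Fin 2) else 0) = 1
    rw [dg_ι]; rfl
  let PU : PerfectionData SU :=
    { Pf := Fin 2
      toPf := toPfU
      root := fun X _ => toPfU.obj X
      root_one := fun _ => rfl
      root_surjective := fun X => by
        fin_cases X
        · exact ⟨S₀.toUntr.obj A₀, 1, h0⟩
        · exact ⟨S₀.toUntr.obj A₁, 1, h1⟩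
      ops := junk _ }
  -- the schema at this data
  obtain ⟨G, ⟨e⟩⟩ := h D natΦ C F P SU PU hF hfi
  -- top composite is constant, bottom composite separates `ι 0` from `ι 1`
  have i : (S₀.toUntr ⋙ toPfU).obj A₁ ≅ (S₀.toUntr ⋙ toPfU).obj A₀ := (e.app A₁).symm ≪≫ e.app A₀
  have hle : (S₀.toUntr ⋙ toPfU).obj A₁ ≤ (S₀.toUntr ⋙ toPfU).obj A₀ := leOfHom i.hom
  rw [h0, h1] at hle
  exact absurd hle (by decide)

end Literature.AlgebraicGeometry.Frobenioids

end
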